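import Summits.ValiantsHypothesis.ValiantsHypothesis.Theorems.LacunarySymmetroidMatrixDescartesOneAlternation
import Summits.ValiantsHypothesis.ValiantsHypothesis.Theorems.LacunarySymmetroidMatrixDescartesPivotRankOneFourNine

/-!
# `MatrixDescartes` census — rank-one `(2,4)₁`, the OUTER splits `0|4` and `4|0`: `Z₊ ≤ 2` (not `8`/`9`)

HONEST FRAMING.  Object-search cell `pub-symmetroid`, seat `val-sym-mdr-p1` (generation 17); helper file `--supports` the crux item
stmt-ValiantsHypothesis-18050 (`Theses.LacunarySymmetroid.MatrixDescartes`, OPEN, on HOLD) with NO closure claim.  Bookkeeping beside the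
crux for the rank-one `(2,4)₁` cell (`F = X^e J + ∑ₖ wₖ X^{dₖ} vₖvₖᵀ`, `J` real symmetric `2 × 2`, `wₖ ≥ 0`, `vₖ ∈ ℝ²`): when ALL four letters lie
on the same side of the pivot (`e < dₖ` for all `k`, or `dₖ < e` for all `k`), the pencil is a ONE-ALTERNATION word in the sense of the tree's
`oneAlternation` / `oneAlternation_mirror` (`…MatrixDescartesOneAlternation`, seat `val-sym-mdr-p2`: Loewner monotonicity of `F/X^e` plus a
kernel chain), so `det F` has AT MOST TWO distinct positive roots — against the Descartes budgets `8` / `9` recorded for these splits in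
`…PivotRankOneFourNine` (`rankOne_posRoots_le_nine`).  Together with that file: the rank-one `(2,4)₁` value `9` can only come from chambers
(C), (C′) of the `1|3`, `3|1` splits; the `2|2` split gives `8`; the outer splits give `2` (`rankOne_posRoots_le_two_of_outer`).  Nothing here
bears on `MatrixDescartes` in its window, on `DoorA26` / `DoorA34`, registers / credences, or `VP ≠ VNP`.

[folklore] Rewriting the explicit five-term pencil as `∑ₖ X^{d'ₖ} • Sₖ` over `Fin 5`; `vecMulVec v v ⪰ 0` (Mathlib
`Matrix.posSemidef_vecMulVec_self_star`, via the tree's `TwoDirections.posSemidef_smul_vecMulVec`); the tree's one-alternation rule.  No definitions, no named facts.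
-/

-- `Summit.ValiantsHypothesis.ValiantsHypothesis.…` repeats a component by the D-0017 layout
-- (single-conjunct summit), which the `dupNamespace` linter flags; the name is mandated.
set_option linter.dupNamespace false

open Polynomial Matrix Finset
open scoped BigOperators

namespace Summit.ValiantsHypothesis.ValiantsHypothesis.Theorems.LacunarySymmetroidMatrixDescartes.Pivot.RankOneCover

/-! ## 1. The explicit five-term pencil as an indexed sum -/

/-- A weighted rank-one letter `(C w · X^d) • (v vᵀ)` equals `X^d • ((w • v vᵀ).map C)`. [folklore] -/
theorem smul_letter_eq (w : ℝ) (d : ℕ) (v : Fin 2 → ℝ) :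
    (Polynomial.C w * (X : ℝ[X]) ^ d) • (vecMulVec v v).map Polynomial.C
      = ((X : ℝ[X]) ^ d) • (w • vecMulVec v v).map Polynomial.C := by
  ext i j
  simp only [Matrix.smul_apply, Matrix.map_apply, smul_eq_mul, Polynomial.C_mul]
  ring

/-- The rank-one four-letter pencil `X^e J + ∑ₖ (C wₖ X^{dₖ}) • vₖvₖᵀ` is the indexed pencil `∑_{i<5} X^{d'ᵢ} • Sᵢ` with
`d' = (e, d₀, d₁, d₂, d₃)` and `S = (J, w₀v₀v₀ᵀ, …, w₃v₃v₃ᵀ)`. [folklore] -/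
theorem rankOne_four_eq_sum (e d₀ d₁ d₂ d₃ : ℕ) (J : Matrix (Fin 2) (Fin 2) ℝ) (v₀ v₁ v₂ v₃ : Fin 2 → ℝ) (w₀ w₁ w₂ w₃ : ℝ) :
    ((X : ℝ[X]) ^ e) • J.map Polynomial.C
        + (Polynomial.C w₀ * X ^ d₀) • (vecMulVec v₀ v₀).map Polynomial.C
        + (Polynomial.C w₁ * X ^ d₁) • (vecMulVec v₁ v₁).map Polynomial.C
        + (Polynomial.C w₂ * X ^ d₂) • (vecMulVec v₂ v₂).map Polynomial.C
        + (Polynomial.C w₃ * X ^ d₃) • (vecMulVec v₃ v₃).map Polynomial.C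
      = ∑ i : Fin 5, ((X : ℝ[X]) ^ ((![e, d₀, d₁, d₂, d₃] : Fin 5 → ℕ) i))
          • (((![J, w₀ • vecMulVec v₀ v₀, w₁ • vecMulVec v₁ v₁, w₂ • vecMulVec v₂ v₂, w₃ • vecMulVec v₃ v₃] :
              Fin 5 → Matrix (Fin 2) (Fin 2) ℝ) i).map Polynomial.C) := by
  rw [smul_letter_eq w₀, smul_letter_eq w₁, smul_letter_eq w₂, smul_letter_eq w₃]
  simp only [Fin.sum_univ_succ, Fin.sum_univ_zero, Matrix.cons_val_zero, Matrix.cons_val_succ, add_zero, add_assoc]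

/-- A weighted rank-one letter `w • v vᵀ` is symmetric. [folklore] -/
theorem isSymm_smul_vecMulVec (w : ℝ) (v : Fin 2 → ℝ) : (w • vecMulVec v v).IsSymm := by
  unfold Matrix.IsSymm
  rw [transpose_smul, transpose_vecMulVec]

/-! ## 2. The outer splits -/

/-- **SPLIT `0|4`: `Z₊ ≤ 2`.**  If every letter exponent exceeds the pivot exponent (`e < dₖ` for all `k`; no ordering or distinctness of the
`dₖ` needed), `J` is real symmetric and the weights are `≥ 0`, then `det (X^e J + ∑ₖ wₖ X^{dₖ} vₖvₖᵀ)` has at most TWO distinct positive roots: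
all letters above the pivot are positive semidefinite, so the pencil is a one-alternation word (`oneAlternation_mirror`).  Descartes alone
gives `8` or `9` here (`rankOne_posRoots_le_nine`). [this file] -/
theorem rankOne_zeroFour_posRoots_le_two (e d₀ d₁ d₂ d₃ : ℕ) (he₀ : e < d₀) (he₁ : e < d₁) (he₂ : e < d₂) (he₃ : e < d₃)
    (J : Matrix (Fin 2) (Fin 2) ℝ) (hJ : J.IsSymm) (v₀ v₁ v₂ v₃ : Fin 2 → ℝ) (w₀ w₁ w₂ w₃ : ℝ)
    (hw₀ : 0 ≤ w₀) (hw₁ : 0 ≤ w₁) (hw₂ : 0 ≤ w₂) (hw₃ : 0 ≤ w₃) :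
    ((Matrix.det (((X : ℝ[X]) ^ e) • J.map Polynomial.C
        + (Polynomial.C w₀ * X ^ d₀) • (vecMulVec v₀ v₀).map Polynomial.C
        + (Polynomial.C w₁ * X ^ d₁) • (vecMulVec v₁ v₁).map Polynomial.C
        + (Polynomial.C w₂ * X ^ d₂) • (vecMulVec v₂ v₂).map Polynomial.C
        + (Polynomial.C w₃ * X ^ d₃) • (vecMulVec v₃ v₃).map Polynomial.C)).roots.toFinset.filter (fun t => 0 < t)).card
      ≤ 2 := by
  rw [rankOne_four_eq_sum]
  have h := oneAlternation_mirror (Fin 2) (Fin 5) e (![e, d₀, d₁, d₂, d₃] : Fin 5 → ℕ)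
    (![J, w₀ • vecMulVec v₀ v₀, w₁ • vecMulVec v₁ v₁, w₂ • vecMulVec v₂ v₂, w₃ • vecMulVec v₃ v₃])
    (fun k => by
      fin_cases k
      · exact hJ
      · exact isSymm_smul_vecMulVec w₀ v₀
      · exact isSymm_smul_vecMulVec w₁ v₁
      · exact isSymm_smul_vecMulVec w₂ v₂
      · exact isSymm_smul_vecMulVec w₃ v₃)
    (fun k hk => by
      fin_cases k <;> simp only [Fin.reduceFinMk, Matrix.cons_val] at hk ⊢ <;> omega)
    (fun k hk => by
      fin_cases k
      · simp only [Fin.reduceFinMk, Matrix.cons_val] at hk; omega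
      · exact TwoDirections.posSemidef_smul_vecMulVec w₀ hw₀ v₀
      · exact TwoDirections.posSemidef_smul_vecMulVec w₁ hw₁ v₁
      · exact TwoDirections.posSemidef_smul_vecMulVec w₂ hw₂ v₂
      · exact TwoDirections.posSemidef_smul_vecMulVec w₃ hw₃ v₃)
  simpa using h

/-- **SPLIT `4|0`: `Z₊ ≤ 2`.**  If every letter exponent is below the pivot exponent (`dₖ < e` for all `k`), `J` is real symmetric and the
weights are `≥ 0`, then `det (X^e J + ∑ₖ wₖ X^{dₖ} vₖvₖᵀ)` has at most TWO distinct positive roots (`oneAlternation`: positive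
semidefinite letters below the pivot, nothing above). [this file] -/
theorem rankOne_fourZero_posRoots_le_two (e d₀ d₁ d₂ d₃ : ℕ) (he₀ : d₀ < e) (he₁ : d₁ < e) (he₂ : d₂ < e) (he₃ : d₃ < e)
    (J : Matrix (Fin 2) (Fin 2) ℝ) (hJ : J.IsSymm) (v₀ v₁ v₂ v₃ : Fin 2 → ℝ) (w₀ w₁ w₂ w₃ : ℝ)
    (hw₀ : 0 ≤ w₀) (hw₁ : 0 ≤ w₁) (hw₂ : 0 ≤ w₂) (hw₃ : 0 ≤ w₃) :
    ((Matrix.det (((X : ℝ[X]) ^ e) • J.map Polynomial.C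
        + (Polynomial.C w₀ * X ^ d₀) • (vecMulVec v₀ v₀).map Polynomial.C
        + (Polynomial.C w₁ * X ^ d₁) • (vecMulVec v₁ v₁).map Polynomial.C
        + (Polynomial.C w₂ * X ^ d₂) • (vecMulVec v₂ v₂).map Polynomial.C
        + (Polynomial.C w₃ * X ^ d₃) • (vecMulVec v₃ v₃).map Polynomial.C)).roots.toFinset.filter (fun t => 0 < t)).card
      ≤ 2 := by
  rw [rankOne_four_eq_sum]
  have h := oneAlternation (Fin 2) (Fin 5) e (![e, d₀, d₁, d₂, d₃] : Fin 5 → ℕ)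
    (![J, w₀ • vecMulVec v₀ v₀, w₁ • vecMulVec v₁ v₁, w₂ • vecMulVec v₂ v₂, w₃ • vecMulVec v₃ v₃])
    (fun k => by
      fin_cases k
      · exact hJ
      · exact isSymm_smul_vecMulVec w₀ v₀
      · exact isSymm_smul_vecMulVec w₁ v₁
      · exact isSymm_smul_vecMulVec w₂ v₂
      · exact isSymm_smul_vecMulVec w₃ v₃)
    (fun k hk => by
      fin_cases k
      · simp only [Fin.reduceFinMk, Matrix.cons_val] at hk; omega
      · exact TwoDirections.posSemidef_smul_vecMulVec w₀ hw₀ v₀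
      · exact TwoDirections.posSemidef_smul_vecMulVec w₁ hw₁ v₁
      · exact TwoDirections.posSemidef_smul_vecMulVec w₂ hw₂ v₂
      · exact TwoDirections.posSemidef_smul_vecMulVec w₃ hw₃ v₃)
    (fun k hk => by
      fin_cases k <;> simp only [Fin.reduceFinMk, Matrix.cons_val] at hk ⊢ <;> omega)
  simpa using h

/-! ## 3. Every position of the pivot, sharpened on the outer splits -/

/-- **RANK-ONE `(2,4)₁`, EVERY POSITION OF THE PIVOT (sharpened).**  `J` real symmetric, `wₖ > 0`, `vₖ ∈ ℝ²` arbitrary, letter exponents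
`d₀ < d₁ < d₂ < d₃` all different from the pivot exponent `e`: `det F` has at most `2` distinct positive roots on the outer splits `0|4`, `4|0`
(all letters on one side of the pivot), and at most `9` in general (`rankOne_posRoots_le_nine`; `8` on the split `2|2`, `7` off chambers (C),
(C′) of the splits `1|3`, `3|1`). [this file] -/
theorem rankOne_posRoots_le_two_of_outer (e d₀ d₁ d₂ d₃ : ℕ) (h01 : d₀ < d₁) (h12 : d₁ < d₂) (h23 : d₂ < d₃)
    (hout : e < d₀ ∨ d₃ < e)
    (J : Matrix (Fin 2) (Fin 2) ℝ) (hJ : J.IsSymm) (v₀ v₁ v₂ v₃ : Fin 2 → ℝ) (w₀ w₁ w₂ w₃ : ℝ)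
    (hw₀ : 0 ≤ w₀) (hw₁ : 0 ≤ w₁) (hw₂ : 0 ≤ w₂) (hw₃ : 0 ≤ w₃) :
    ((Matrix.det (((X : ℝ[X]) ^ e) • J.map Polynomial.C
        + (Polynomial.C w₀ * X ^ d₀) • (vecMulVec v₀ v₀).map Polynomial.C
        + (Polynomial.C w₁ * X ^ d₁) • (vecMulVec v₁ v₁).map Polynomial.C
        + (Polynomial.C w₂ * X ^ d₂) • (vecMulVec v₂ v₂).map Polynomial.C
        + (Polynomial.C w₃ * X ^ d₃) • (vecMulVec v₃ v₃).map Polynomial.C)).roots.toFinset.filter (fun t => 0 < t)).card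
      ≤ 2 := by
  rcases hout with h | h
  · exact rankOne_zeroFour_posRoots_le_two e d₀ d₁ d₂ d₃ h (by omega) (by omega) (by omega) J hJ v₀ v₁ v₂ v₃
      w₀ w₁ w₂ w₃ hw₀ hw₁ hw₂ hw₃
  · exact rankOne_fourZero_posRoots_le_two e d₀ d₁ d₂ d₃ (by omega) (by omega) (by omega) h J hJ v₀ v₁ v₂ v₃
      w₀ w₁ w₂ w₃ hw₀ hw₁ hw₂ hw₃

end Summit.ValiantsHypothesis.ValiantsHypothesis.Theorems.LacunarySymmetroidMatrixDescartes.Pivot.RankOneCover
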